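import Mathlib
import Summits.ValiantsHypothesis.ValiantsHypothesis.Theorems.GrenetZeonHessianRankCodimTwoLatinPermModel
import Summits.ValiantsHypothesis.ValiantsHypothesis.Theorems.GrenetZeonHessianRankCodimTwoLatinTableDefs
import HarnessLib

/-!
# The Latin block plane, `r = 0`: the TABLE IDENTITY (fibre count), I — engine and permanent table

Part B of the formalisation of "Theorem P" for the crux `GrenetZeon.HessianRankCodimTwo`
(stmt-ValiantsHypothesis-8061, line `good_plane`, `Cruxes/HessianRankCodimTwo/GoodPlanesLatinReduction.md`
§6, §8).  The permanent of the Latin block point of size `n = 3p` and its nine block values are,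
by `…LatinPermModel`, the integer polynomials `permPoly p = Σ_σ Π_i X_{dIdx (σ i) i}` and
`blockPoly p hp I J` (the same sum pinned at two positions).  A permutation contributes a monomial
that depends only on the COLOURING `u = rowBlock ∘ σ⁻¹ : rows → Fin 3` (which column block each row
uses), and every admissible colouring is hit by the same number of permutations.  This file:

* the general engine `sum_perm_comp_eq_smul_sum`: a weight depending on `τ ∈ Perm α` only through
  `v ∘ τ` sums to `Π_k |v⁻¹k|!` times the sum over the maps `u` equi-fibred with `v` (fibre count via
  Mathlib's `DomMulAct.stabilizer_card`, existence via `Equiv.ofFiberEquiv`);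
* `rowBlock`, `dIdx r c = rowBlock c − rowBlock r`, each block has `p` indices;
* `permPoly p = (p!)³ • permTable p` with `permTable p = Σ_{u : |u⁻¹ K| = p ∀ K} Π_r X_{u r − rowBlock r}`
  (`permPoly_eq_smul_permTable`), `permTable` homogeneous of degree `3p`, its generating function
  side `Π_r f(rowBlock r) = Π_K f K ^ p`, and over `ℂ`: `per(latinPoint p 0 a) = (p!)³ · Φ̃_p(a)`, so
  the permanent vanishes on the plane iff `aeval a (permTable p) = 0`.

The block values are treated the same way in `…LatinBlockTable.lean`.  The bridge
`permTable = coeff_{(p,p,p)} Π_I ℓ_I^p` for the circulant row forms and the Frobenius congruences are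
parts A/C (other files).  Nothing here moves VP ≠ VNP: the crux feeds only the constant-factor bound
`TwoDimCoefficients`, and this is bookkeeping inside one infinite family `n = 3p`.
-/

noncomputable section

open MvPolynomial Finset Equiv
open Literature.Computability.AlgebraicComplexity

-- single-conjunct layout `Summits/ValiantsHypothesis/ValiantsHypothesis`: duplicated namespace by design
set_option linter.dupNamespace false

namespace Summit.ValiantsHypothesis.ValiantsHypothesis.Theorems.GrenetZeonHessianRankCodimTwo

/-! ### General engine: sums over permutations of weights factoring through a labelling -/

section Engine

variable {α κ : Type*} [Fintype α] [DecidableEq κ]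

/-- If `v ∘ τ = u` for a permutation `τ`, the fibres of `u` and `v` are equipotent.
[folklore] -/
theorem card_fiber_eq_of_comp_perm_eq (v u : α → κ) (τ : Perm α) (h : v ∘ τ = u) (k : κ) :
    Fintype.card {a // u a = k} = Fintype.card {a // v a = k} := by
  refine Fintype.card_congr (Equiv.subtypeEquiv τ fun a => ?_)
  rw [← h, Function.comp_apply]

/-- Two maps out of a finite type with equipotent fibres differ by a permutation of the source.
[folklore] -/
theorem exists_perm_comp_eq (v u : α → κ)
    (h : ∀ k, Fintype.card {a // u a = k} = Fintype.card {a // v a = k}) :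
    ∃ τ : Perm α, v ∘ τ = u :=
  ⟨Equiv.ofFiberEquiv (f := u) (g := v) fun k => Fintype.equivOfCardEq (h k),
    funext fun a => Equiv.ofFiberEquiv_map _ a⟩

variable [DecidableEq α] [Fintype κ]

/-- **Fibre count.** The number of permutations `τ` of a finite type with `v ∘ τ = u` is
`∏_k |v⁻¹ k|!` if `u` and `v` have equipotent fibres, and `0` otherwise. [folklore] -/
theorem card_filter_comp_perm_eq (v u : α → κ)
    [Decidable (∀ k, Fintype.card {a // u a = k} = Fintype.card {a // v a = k})] :
    #(univ.filter fun τ : Perm α => v ∘ τ = u) =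
      if ∀ k, Fintype.card {a // u a = k} = Fintype.card {a // v a = k} then
        ∏ k, (Fintype.card {a // v a = k}).factorial else 0 := by
  split_ifs with h
  · obtain ⟨τ₀, hτ₀⟩ := exists_perm_comp_eq v u h
    rw [← DomMulAct.stabilizer_card v, Fintype.card_subtype]
    refine Finset.card_nbij' (fun τ => τ * τ₀⁻¹) (fun σ => σ * τ₀) ?_ ?_ ?_ ?_
    · intro τ hτ
      have hτ' : v ∘ τ = u := (Finset.mem_filter.mp hτ).2
      refine Finset.mem_coe.mpr (Finset.mem_filter.mpr ⟨Finset.mem_univ _, ?_⟩)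
      funext a
      have h1 := congrFun hτ' (τ₀.symm a)
      have h2 := congrFun hτ₀ (τ₀.symm a)
      simp only [Function.comp_apply, Equiv.apply_symm_apply] at h1 h2
      simp only [Function.comp_apply, Perm.coe_mul, Perm.coe_inv]
      rw [h1]
      exact h2.symm
    · intro σ hσ
      have hσ' : v ∘ σ = v := (Finset.mem_filter.mp hσ).2
      refine Finset.mem_coe.mpr (Finset.mem_filter.mpr ⟨Finset.mem_univ _, ?_⟩)
      funext a
      have h1 := congrFun hσ' (τ₀ a)
      have h2 := congrFun hτ₀ a
      simp only [Function.comp_apply] at h1 h2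
      simp only [Function.comp_apply, Perm.coe_mul]
      rw [h1, h2]
    · intro τ _
      simp
    · intro σ _
      simp
  · rw [Finset.card_eq_zero, Finset.filter_eq_empty_iff]
    intro τ _ hτ
    exact h (card_fiber_eq_of_comp_perm_eq v u τ hτ)

/-- **Table identity (general engine).** For a weight `Φ` depending on a permutation `τ` only
through the composite `v ∘ τ`, the sum over all permutations equals `∏_k |v⁻¹ k|!` times the
sum of `Φ` over all maps `u` whose fibres are equipotent with those of `v`. [folklore] -/
theorem sum_perm_comp_eq_smul_sum {M : Type*} [AddCommMonoid M] (v : α → κ) (Φ : (α → κ) → M)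
    [DecidablePred fun u : α → κ =>
      ∀ k, Fintype.card {a // u a = k} = Fintype.card {a // v a = k}] :
    ∑ τ : Perm α, Φ (v ∘ τ) =
      (∏ k, (Fintype.card {a // v a = k}).factorial) •
        ∑ u ∈ univ.filter (fun u : α → κ =>
            ∀ k, Fintype.card {a // u a = k} = Fintype.card {a // v a = k}), Φ u := by
  rw [← Finset.sum_fiberwise' univ (fun τ : Perm α => v ∘ τ) Φ]
  have hinner : ∀ u : α → κ, ∑ τ ∈ univ.filter (fun τ : Perm α => v ∘ τ = u), Φ u =
      (if ∀ k, Fintype.card {a // u a = k} = Fintype.card {a // v a = k} then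
        ∏ k, (Fintype.card {a // v a = k}).factorial else 0) • Φ u := by
    intro u
    rw [Finset.sum_const, card_filter_comp_perm_eq]
  simp_rw [hinner, ite_smul, zero_smul]
  rw [← Finset.sum_filter, Finset.smul_sum]

end Engine

/-! ### The row/column blocks of `Fin (3p)` -/

section Latin

variable {p : ℕ}

/-- The variable index `dIdx r c` of the entry `(r, c)` is `rowBlock c − rowBlock r` in `Fin 3`.
[folklore] -/
theorem dIdx_eq_sub (r c : Fin (3 * p + 0)) : dIdx p r c = rowBlock p c - rowBlock p r := by
  rw [eq_sub_iff_add_eq, Fin.ext_iff, Fin.val_add]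
  have hr : r.val / p < 3 := (rowBlock p r).isLt
  have hc : c.val / p < 3 := (rowBlock p c).isLt
  simp only [dIdx, rowBlock]
  generalize r.val / p = a at hr ⊢
  generalize c.val / p = b at hc ⊢
  omega

/-- The chosen rows/columns `blockIdx I s = I·p + s` lie in block `I`. [folklore] -/
theorem rowBlock_blockIdx (hp : 2 ≤ p) (I : Fin 3) (s : Fin 2) :
    rowBlock p (blockIdx p 0 hp I s) = I := by
  apply Fin.ext
  have hs := s.isLt
  show (I.val * p + s.val) / p = I.val
  rw [show I.val * p + s.val = s.val + p * I.val by ring, Nat.add_mul_div_left _ _ (by omega),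
    Nat.div_eq_of_lt (by omega), zero_add]

/-- Each block has exactly `p` indices (filter form). [folklore] -/
theorem card_filter_rowBlock_eq (hp : 0 < p) (K : Fin 3) :
    #(univ.filter fun c : Fin (3 * p + 0) => rowBlock p c = K) = p := by
  let emb : Fin p ↪ Fin (3 * p + 0) :=
    ⟨fun s => ⟨K.val * p + s.val, by have := K.isLt; have := s.isLt; nlinarith⟩,
      fun s t hst => by
        apply Fin.ext
        have := congrArg Fin.val hst
        simp only at this
        omega⟩
  have h : (univ.filter fun c : Fin (3 * p + 0) => rowBlock p c = K) = univ.map emb := by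
    ext c
    simp only [mem_filter, mem_univ, true_and, mem_map, Fin.ext_iff, rowBlock, emb,
      Function.Embedding.coeFn_mk]
    constructor
    · intro hc
      refine ⟨⟨c.val % p, Nat.mod_lt _ hp⟩, ?_⟩
      have := Nat.div_add_mod c.val p
      rw [hc] at this
      simp only
      linarith [Nat.mul_comm p K.val]
    · rintro ⟨s, hs⟩
      rw [← hs]
      rw [show K.val * p + s.val = s.val + p * K.val by ring, Nat.add_mul_div_left _ _ hp,
        Nat.div_eq_of_lt s.isLt, zero_add]
  rw [h, card_map, card_univ, Fintype.card_fin]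

/-- Each block has exactly `p` indices. [folklore] -/
theorem card_rowBlock_fiber (hp : 0 < p) (K : Fin 3) :
    Fintype.card {c : Fin (3 * p + 0) // rowBlock p c = K} = p := by
  rw [Fintype.card_subtype, card_filter_rowBlock_eq hp K]

/-! ### The permanent table -/

/-- **Table identity for the permanent:** `permPoly p = (p!)³ • permTable p`. [folklore] -/
theorem permPoly_eq_smul_permTable (hp : 0 < p) :
    permPoly p = (p.factorial ^ 3) • permTable p := by
  have h1 : ∀ σ : Perm (Fin (3 * p + 0)),
      ∏ i, (X (dIdx p (σ i) i) : MvPolynomial (Fin 3) ℤ) =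
        ∏ r, X (rowBlock p (σ⁻¹ r) - rowBlock p r) := by
    intro σ
    rw [← Equiv.prod_comp σ (fun r => (X (rowBlock p (σ⁻¹ r) - rowBlock p r) :
      MvPolynomial (Fin 3) ℤ))]
    refine Fintype.prod_congr _ _ fun i => ?_
    simp only [dIdx_eq_sub, Perm.coe_inv, Equiv.symm_apply_apply]
  have h2 : ∑ σ : Perm (Fin (3 * p + 0)),
      ∏ r, (X (rowBlock p (σ⁻¹ r) - rowBlock p r) : MvPolynomial (Fin 3) ℤ) =
      ∑ τ : Perm (Fin (3 * p + 0)),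
        (fun u : Fin (3 * p + 0) → Fin 3 => ∏ r, (X (u r - rowBlock p r) : MvPolynomial (Fin 3) ℤ))
          (rowBlock p ∘ τ) :=
    Fintype.sum_equiv (Equiv.inv (Perm (Fin (3 * p + 0)))) _ _ fun σ => rfl
  unfold permPoly
  rw [Finset.sum_congr rfl fun σ _ => h1 σ, h2,
    sum_perm_comp_eq_smul_sum (rowBlock p)
      (fun u : Fin (3 * p + 0) → Fin 3 => ∏ r, (X (u r - rowBlock p r) : MvPolynomial (Fin 3) ℤ))]
  have hN : ∏ k : Fin 3, (Fintype.card {a : Fin (3 * p + 0) // rowBlock p a = k}).factorial =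
      p.factorial ^ 3 := by
    simp_rw [card_rowBlock_fiber hp]
    rw [Finset.prod_const, card_univ, Fintype.card_fin]
  unfold permTable
  rw [hN]
  congr 1
  refine Finset.sum_congr (Finset.filter_congr fun u _ => ?_) fun _ _ => rfl
  simp_rw [card_rowBlock_fiber hp]

/-- `Π_r f(rowBlock r) = Π_K f(K)^p` (each block has `p` rows); with `f = ℓ` the circulant row forms
this says that the generating function of `permTable` is `Π_I ℓ_I^p`. [folklore] -/
theorem prod_comp_rowBlock_eq {M : Type*} [CommMonoid M] (hp : 0 < p) (f : Fin 3 → M) :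
    ∏ r : Fin (3 * p + 0), f (rowBlock p r) = ∏ K, f K ^ p := by
  rw [← Finset.prod_fiberwise' univ (rowBlock p) f]
  refine Fintype.prod_congr _ _ fun K => ?_
  rw [Finset.prod_const, card_filter_rowBlock_eq hp]

/-- `permTable p` is homogeneous of degree `3p`. [folklore] -/
theorem permTable_isHomogeneous (p : ℕ) : (permTable p).IsHomogeneous (3 * p + 0) := by
  unfold permTable
  refine IsHomogeneous.sum _ _ _ fun u _ => ?_
  have h := IsHomogeneous.prod Finset.univ (fun r : Fin (3 * p + 0) =>
    (X (u r - rowBlock p r) : MvPolynomial (Fin 3) ℤ)) (fun _ => 1) fun r _ => isHomogeneous_X _ _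
  simpa using h

/-! ### Consequences over `ℂ`: the Latin point -/

/-- The permanent of the Latin block point (`r = 0`) is `(p!)³ · Φ̃_p(a)`. [folklore] -/
theorem eval_perPoly_latinPoint_zero_eq_mul_permTable (hp : 0 < p) (a : Fin 3 → ℂ) :
    MvPolynomial.eval (latinPoint p 0 a) (perPoly (Fin (3 * p + 0)) ℂ) =
      ((p.factorial ^ 3 : ℕ) : ℂ) * aeval a (permTable p) := by
  rw [eval_perPoly_latinPoint_zero, permPoly_eq_smul_permTable hp, map_nsmul, nsmul_eq_mul]

/-- On the Latin block plane (`r = 0`) the permanent vanishes iff the normalised table `Φ̃_p`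
does. [folklore] -/
theorem eval_perPoly_latinPoint_zero_eq_zero_iff (hp : 0 < p) (a : Fin 3 → ℂ) :
    MvPolynomial.eval (latinPoint p 0 a) (perPoly (Fin (3 * p + 0)) ℂ) = 0 ↔
      aeval a (permTable p) = 0 := by
  rw [eval_perPoly_latinPoint_zero_eq_mul_permTable hp, mul_eq_zero, or_iff_right]
  exact_mod_cast pow_ne_zero 3 (Nat.factorial_ne_zero p)

end Latin

end Summit.ValiantsHypothesis.ValiantsHypothesis.Theorems.GrenetZeonHessianRankCodimTwo
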